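import Literature.NumberTheory.EllipticCurves.FourTorsionResolventCocycleProofs
import Literature.NumberTheory.EllipticCurves.TwoAdicImageModFourClauseTwoReductionProofs
import Literature.NumberTheory.EllipticCurves.TwoAdicImageSurjectivityProofs
import HarnessLib

/-!
# Dokchitser–Dokchitser's Lemma, clause (2), and the whole Theorem — PROVED

Sorry-free `Proofs` companion (theorems only; no named fact, no instance; D-0014/D-0026): the
third file of the level-`4` road.  T. Dokchitser, V. Dokchitser, *Surjectivity of mod `2ⁿ`
representations of elliptic curves*, Math. Z. 272 (2012) 961–964, LEMMA (p. 962): for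
`E : y² = x³ + ax + b`, `b ≠ 0`, "`Gal(ℚ(E[4])/ℚ)` is conjugate to a subgroup of `ℍ`" ⟺ "`f` has a
rational root" ⟺ "`j(E) = -4t³(t + 8)` for some `t ∈ ℚ`".  The printed proof builds the resolvent
`∏_C (x - θ_C)`, `θ_C = Σ_{g ∈ C} x(gP)x(gQ)` over the four cosets of `ℍ`, and identifies it with
`f(4x)` "numerically for a few specialisations … and rounding the coefficients".  Here the SAME
resolvent idea is carried out EXACTLY, with the four classes `w_η` of
`FourTorsionResolventCocycleProofs` in place of the `θ_C`:

* §1 `∏_η (X - 4w_η) = X⁴ + 512δ²X + 256(Σu)δ²`, i.e. (`Δ = 16δ²`, `4Σu = c₄`) the four `w_η` are the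
  roots of `64X⁴ + 32ΔX + c₄Δ` — which is `64·f(a - X)` for `y² = x³ + ax + b` (`c₄ = -48a`,
  `Δ = -16(4a³ + 27b²)`): Dokchitser–Dokchitser's quartic up to the substitution `x = a - X`
  (`prod_sub_four_mul_w`; certificate found with a computer algebra system, checked by
  `linear_combination`);
* §2 the printed step (2) ⟺ (3) of the Lemma in invariant form: `64q⁴ + 32Δq + c₄Δ = 0` for some
  `q ∈ K` iff `j = c₄³/Δ = -4t³(t + 8)` for some `t ∈ K` (`t = c₄/(4q)`; loc. cit.:
  "`j = -27648(2u+1)/(u-1)⁴`. Replacing `u` by `12/t + 1` we get `j = -4t³(t+8)`");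
* §3 (1) ⟹ (3): if a conjugate of `Im ρ̄₄` lies in `ℍ` then the part of the image that is
  `≡ 1 (mod 2)` lies in `{±1, ±(1 + 2w₀)}` and acts trivially on the four classes, so the action
  factors through `GL₂(𝔽₂) ≅ S₃`, whose `3`-cycle fixes exactly one class; that class is then fixed
  by all of `Γ_K` ("the stabiliser of `θ_ℍ` is precisely `ℍ`"), i.e. one `w_η` is in `K`;
* §4 (3) ⟹ (1): a `K`-rational root is some `w_η`, fixed by `Γ_K`; were `ρ̄₄` onto, a `σ` with
  `ρ̄₄(σ) = diag(3, 1)` would move every class — so, by door B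
  (`hasSurjectiveModNGaloisRep_four_or_conj_subset_HH`), the image is conjugate into `ℍ`;
* §5 the Lemma over `ℚ` in the exact hypothesis spelling of
  `TwoAdicImageModFourClauseTwoReductionProofs` (`conj_subset_HH_iff_exists_j_eq`), hence
  **clause (2)** `hasSurjectiveModNGaloisRep_four_iff` and the DISCHARGE
  **`DokchitserDokchitser2012_surjective_mod_two_four_eight_holds`** of the named fact (clauses
  (1), (3) being `hasSurjectiveModNGaloisRep_two_iff`, `…_eight_iff`); and, both named facts of
  `TwoAdicImageSurjectivity` being theorems now (the `2`-adic lift is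
  `hasSurjectiveModNGaloisRep_two_pow_of_eight_holds` of `TwoAdicImageSurjectivityProofs`), the
  per-curve criterion for a surjective `2`-adic image UNCONDITIONALLY
  (`twoAdicImage_surjective_of_criteria`).

Hypotheses versus print: the Lemma is proved under `ρ̄₂` onto (which the Theorem's clause (2)
supplies on both sides) instead of DD's weaker standing assumption; `ρ̄₂` onto forces `b ≠ 0`
(`c₆ ≠ 0`, `j ≠ 1728`; here: the three `u_i` are distinct), so the `c₆ ≠ 0` binder of the
reduction file is accepted but not used.

## References

* [DokchitserDokchitserMathZ2012] T. Dokchitser, V. Dokchitser, Math. Z. 272 (2012) 961–964,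
  Theorem and Lemma with proofs. [corpus:paper:arxiv-1104.5031 p0001 L32–L171, p0002 L1–L24]
* [SilvermanAEC2009] J. H. Silverman, *The Arithmetic of Elliptic Curves*, 2nd ed., GTM 106
  (2009), III.§1 (`j = c₄³/Δ`), III.7, VIII.1.
-/

set_option autoImplicit false

/-! ### §0. Kernel-decidable facts about `ℍ ∩ (1 + 2M₂(𝔽₂))` -/

namespace Literature.NumberTheory.EllipticCurves.DokchitserDokchitser2012.LevelFour

open Literature.NumberTheory.GaloisRepresentations.GL2Mod8 (P4 P4.det)
open Literature.NumberTheory.GaloisRepresentations.GL2Mod4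

set_option synthInstance.maxSize 4096 in
set_option maxRecDepth 100000 in
set_option maxHeartbeats 0 in
/-- Kernel elements of `ℍ`: `h ∈ ℍ` with `h ≡ 1 (mod 2)` is `klift a` with `a ∈ 𝔽₂[ω̄]`.
[cite: DokchitserDokchitserMathZ2012, proof of Theorem (2) (the subgroup ℍ of index 4)] -/
theorem klift_mem_HH_imp : ∀ a : P4, klift a ∈ HH → a ∈ F4set := by
  decide +kernel

set_option synthInstance.maxSize 4096 in
/-- `𝔽₂[ω̄]` is stable under conjugation by `GL₂(𝔽₂)`. [cite: DokchitserDokchitserMathZ2012, proof of Theorem (2) (ℍ is determined up to conjugacy)] -/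
theorem mem_F4set_of_conj_mem :
    ∀ p : P4, P4.det p = 1 → ∀ a : P4, P4.conj p a ∈ F4set → a ∈ F4set := by
  decide

set_option synthInstance.maxSize 4096 in
/-- The four tuples `klift a`, `a ∈ 𝔽₂[ω̄]`: `1, 3·1, 1 + 2w₀, 3 + 2w₀`. [folklore] -/
private theorem klift_F4set_cases : ∀ a : P4, a ∈ F4set →
    klift a = (1, 0, 0, 1) ∨ klift a = (3, 0, 0, 3) ∨ klift a = (1, 2, 2, 3) ∨
      klift a = (3, 2, 2, 1) := by
  decide

end Literature.NumberTheory.EllipticCurves.DokchitserDokchitser2012.LevelFour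

noncomputable section

open scoped Classical

open Matrix WeierstrassCurve

namespace Literature.NumberTheory.EllipticCurves.DokchitserDokchitser2012

open Literature.NumberTheory.GaloisRepresentations.GL2Mod8 (P4 P4.mul P4.det sgnUnit
  sgnUnit_zero sgnUnit_one sgnUnit_add)
open Literature.NumberTheory.GaloisRepresentations.GL2Mod4

universe u

variable {K : Type u} [Field K] (W : WeierstrassCurve K) [W.IsElliptic] (h2 : (2 : K) ≠ 0)

/-! ### §1. The resolvent: `∏_η (X - 4w_η) = X⁴ + 512δ²X + 256(Σu)δ²` -/

namespace LevelFour

include h2 in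
/-- `2 ≠ 0`, `4 ≠ 0` in `K̄`. [folklore] -/
private theorem two_four_ne_zero' :
    (2 : AlgebraicClosure K) ≠ 0 ∧ (4 : AlgebraicClosure K) ≠ 0 := by
  have h2' : (2 : AlgebraicClosure K) ≠ 0 := fun h0 ↦
    h2 ((algebraMap K (AlgebraicClosure K)).injective (by rw [map_ofNat, h0, map_zero]))
  exact ⟨h2', by rw [show (4 : AlgebraicClosure K) = 2 * 2 by norm_num]; exact mul_ne_zero h2' h2'⟩

/-- The symmetric functions of `u_{f 0}, u_{f 1}, u_{f 2}` are those of `u₀, u₁, u₂`: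
`Σ`, `∏ = -64δ²`, and `Σ_{i<j} u_iu_j = 0`. [cite: DokchitserDokchitserMathZ2012, Lemma (p. 962), proof (the coefficients λ_i of the resolvent)] -/
theorem uT_letter_symm :
    uT W h2 (letter W h2 0) + uT W h2 (letter W h2 1) + uT W h2 (letter W h2 2) =
        uT W h2 0 + uT W h2 1 + uT W h2 2 ∧
      uT W h2 (letter W h2 0) * uT W h2 (letter W h2 1) * uT W h2 (letter W h2 2) =
        -64 * delta W h2 ^ 2 ∧
      uT W h2 (letter W h2 0) * uT W h2 (letter W h2 1) +
          uT W h2 (letter W h2 0) * uT W h2 (letter W h2 2) +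
          uT W h2 (letter W h2 1) * uT W h2 (letter W h2 2) = 0 := by
  obtain ⟨h2', -⟩ := two_four_ne_zero' (K := K) h2
  have hs1 := Equiv.sum_comp (letterEquiv W h2) (uT W h2)
  have hs2 := Equiv.sum_comp (letterEquiv W h2) (fun k ↦ uT W h2 k ^ 2)
  have hp3 := Equiv.prod_comp (letterEquiv W h2) (uT W h2)
  simp only [Fin.sum_univ_three, Fin.prod_univ_three, letterEquiv, Equiv.ofBijective_apply]
    at hs1 hs2 hp3
  have hσ2 : uT W h2 0 * uT W h2 1 + uT W h2 0 * uT W h2 2 + uT W h2 1 * uT W h2 2 = 0 := by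
    obtain ⟨h0, h1, h2e⟩ := uT_eq W h2
    rw [h0, h1, h2e]; ring
  refine ⟨hs1, by rw [hp3, prod_uT], ?_⟩
  apply mul_left_cancel₀ h2'
  linear_combination (uT W h2 (letter W h2 0) + uT W h2 (letter W h2 1) + uT W h2 (letter W h2 2) +
    (uT W h2 0 + uT W h2 1 + uT W h2 2)) * hs1 - hs2 + 2 * hσ2

/-- `w_η` written out: `w_η = (-1)^{η₀} v₁v₂ + (-1)^{η₁} v₂v₀ + (-1)^{η₀+η₁} v₀v₁`. [cite: DokchitserDokchitserMathZ2012, Lemma (p. 962), proof (the θ_C)] -/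
theorem w_eq (η : ZMod 2 × ZMod 2) : w W h2 η =
    (sgnUnit (etaf η 0) : AlgebraicClosure K) * (v W h2 1 * v W h2 2) +
      (sgnUnit (etaf η 1) : AlgebraicClosure K) * (v W h2 2 * v W h2 0) +
      (sgnUnit (etaf η 2) : AlgebraicClosure K) * (v W h2 0 * v W h2 1) := by
  rw [w, Fin.sum_univ_three]
  rfl

/-- **The resolvent.** `∏_η (X - 4w_η) = X⁴ + 512δ²X + 256(u₀ + u₁ + u₂)δ²`; with `Δ = 16δ²` and
`4Σu_i = c₄` this says that the `w_η` are the four roots of `64X⁴ + 32ΔX + c₄Δ`, Dokchitser–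
Dokchitser's `f` up to `x = a - X` (`f(a - X) = X⁴ + (Δ/2)X + c₄Δ/64` for `y² = x³ + ax + b`).
Identity in `v₀, v₁, v₂` modulo `4v_i² = u_i`, `Σ_{i<j} u_iu_j = 0`, `u₀u₁u₂ = -64δ²`.
[cite: DokchitserDokchitserMathZ2012, Lemma (p. 962), proof ("we find that f̃(x) = f(4x)")] -/
theorem prod_sub_four_mul_w (X : AlgebraicClosure K) :
    ∏ η : ZMod 2 × ZMod 2, (X - 4 * w W h2 η) =
      X ^ 4 + 512 * delta W h2 ^ 2 * X + 256 * (uT W h2 0 + uT W h2 1 + uT W h2 2) * delta W h2 ^ 2 := by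
  obtain ⟨hs1, hp3, hσ2⟩ := uT_letter_symm W h2
  have hV0 := four_mul_v_sq W h2 0
  have hV1 := four_mul_v_sq W h2 1
  have hV2 := four_mul_v_sq W h2 2
  have h11 : (1 : ZMod 2) + 1 = 0 := by decide
  rw [← hs1, show (Finset.univ : Finset (ZMod 2 × ZMod 2)) = {(0, 0), (1, 0), (0, 1), (1, 1)} from
    by decide, Finset.prod_insert (by decide), Finset.prod_insert (by decide),
    Finset.prod_insert (by decide), Finset.prod_singleton]
  simp only [w_eq, etaf, Matrix.cons_val_zero, Matrix.cons_val_one, Matrix.cons_val, sgnUnit_zero,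
    sgnUnit_one, Int.cast_one, Int.cast_neg, zero_add, add_zero, h11]
  set a0 := v W h2 0
  set a1 := v W h2 1
  set a2 := v W h2 2
  set U0 := uT W h2 (letter W h2 0)
  set U1 := uT W h2 (letter W h2 1)
  set U2 := uT W h2 (letter W h2 2)
  set d := delta W h2
  linear_combination
    (16 * U0 * a1 ^ 4 - 32 * U0 * a1 ^ 2 * a2 ^ 2 + 16 * U0 * a2 ^ 4 - 8 * X ^ 2 * a1 ^ 2 -
      8 * X ^ 2 * a2 ^ 2 - 128 * X * a1 ^ 2 * a2 ^ 2 + 64 * a0 ^ 2 * a1 ^ 4 -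
      128 * a0 ^ 2 * a1 ^ 2 * a2 ^ 2 + 64 * a0 ^ 2 * a2 ^ 4 - 128 * a1 ^ 4 * a2 ^ 2 -
      128 * a1 ^ 2 * a2 ^ 4) * hV0 +
    (U0 ^ 2 * U1 + 4 * U0 ^ 2 * a1 ^ 2 - 8 * U0 ^ 2 * a2 ^ 2 - 8 * U0 * U1 * a2 ^ 2 -
      2 * U0 * X ^ 2 - 32 * U0 * X * a2 ^ 2 - 32 * U0 * a1 ^ 2 * a2 ^ 2 - 32 * U0 * a2 ^ 4 +
      16 * U1 * a2 ^ 4 - 8 * X ^ 2 * a2 ^ 2 + 64 * a1 ^ 2 * a2 ^ 4) * hV1 +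
    (-2 * U0 ^ 2 * U1 + U0 ^ 2 * U2 + 4 * U0 ^ 2 * a2 ^ 2 - 2 * U0 * U1 ^ 2 - 2 * U0 * U1 * U2 -
      8 * U0 * U1 * X - 8 * U0 * U1 * a2 ^ 2 - 2 * U0 * X ^ 2 + U1 ^ 2 * U2 +
      4 * U1 ^ 2 * a2 ^ 2 - 2 * U1 * X ^ 2) * hV2 +
    (U0 * U1 + U0 * U2 + U1 * U2 - 2 * X ^ 2) * hσ2 +
    (-4 * U0 - 4 * U1 - 4 * U2 - 8 * X) * hp3

/-- **The `w_η` are the roots of `64X⁴ + 32ΔX + c₄Δ` in `K`-terms:**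
`∏_η (4q - 4w_η) = 4 · (64q⁴ + 32Δq + c₄Δ)` for `q ∈ K`.
[cite: DokchitserDokchitserMathZ2012, Lemma (p. 962), proof (f̃ has coefficients in K)] -/
theorem prod_sub_four_mul_w_algebraMap (q : K) :
    ∏ η : ZMod 2 × ZMod 2, (4 * algebraMap K (AlgebraicClosure K) q - 4 * w W h2 η) =
      4 * algebraMap K (AlgebraicClosure K) (64 * q ^ 4 + 32 * W.Δ * q + W.c₄ * W.Δ) := by
  rw [prod_sub_four_mul_w, map_add, map_add, map_mul, map_mul, map_mul, map_mul, map_pow,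
    map_ofNat, map_ofNat, algebraMap_Δ W h2, ← four_mul_sum_uT W h2]
  ring

/-- A `K`-rational root `q` of `64X⁴ + 32ΔX + c₄Δ` IS one of the classes: `w_η = q` for some `η`.
[cite: DokchitserDokchitserMathZ2012, Lemma (p. 962), proof ("if f has a rational root")] -/
theorem exists_w_eq_of_root {q : K} (hq : 64 * q ^ 4 + 32 * W.Δ * q + W.c₄ * W.Δ = 0) :
    ∃ η : ZMod 2 × ZMod 2, w W h2 η = algebraMap K (AlgebraicClosure K) q := by
  obtain ⟨-, h4'⟩ := two_four_ne_zero' (K := K) h2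
  have h := prod_sub_four_mul_w_algebraMap W h2 q
  rw [hq, map_zero, mul_zero, Finset.prod_eq_zero_iff] at h
  obtain ⟨η, -, hη⟩ := h
  refine ⟨η, ?_⟩
  have : 4 * (algebraMap K (AlgebraicClosure K) q - w W h2 η) = 0 := by linear_combination hη
  linear_combination -((mul_eq_zero.mp this).resolve_left h4')

/-- Conversely a class `w_η` lying in `K` is a root of `64X⁴ + 32ΔX + c₄Δ`.
[cite: DokchitserDokchitserMathZ2012, Lemma (p. 962), proof ("one of the θ_C is rational, equivalently f has a rational root")] -/
theorem root_of_w_eq {q : K} {η : ZMod 2 × ZMod 2}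
    (hη : w W h2 η = algebraMap K (AlgebraicClosure K) q) :
    64 * q ^ 4 + 32 * W.Δ * q + W.c₄ * W.Δ = 0 := by
  obtain ⟨-, h4'⟩ := two_four_ne_zero' (K := K) h2
  have h := prod_sub_four_mul_w_algebraMap W h2 q
  rw [Finset.prod_eq_zero (Finset.mem_univ η) (by rw [hη, sub_self])] at h
  exact (algebraMap K (AlgebraicClosure K)).injective
    (by rw [map_zero]; exact ((mul_eq_zero.mp h.symm).resolve_left h4'))

end LevelFour

/-! ### §2. `64q⁴ + 32Δq + c₄Δ = 0` versus `j = -4t³(t + 8)` -/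

/-- `j·Δ = c₄³`. [cite: SilvermanAEC2009, III.§1 (j = c₄³/Δ)] -/
theorem j_mul_Δ : W.j * W.Δ = W.c₄ ^ 3 := by
  rw [WeierstrassCurve.j, mul_assoc, mul_comm (W.c₄ ^ 3), ← mul_assoc, ← W.coe_Δ', Units.inv_mul,
    one_mul]

include h2 in
/-- **(2) ⟹ (3) of the Lemma, invariant form:** a root `q ∈ K` of `64X⁴ + 32ΔX + c₄Δ` gives
`j = -4t³(t + 8)` with `t = c₄/(4q)` (`t = 0` if `c₄ = 0`). Print: "`u = r/a` …
`j = -27648(2u+1)/(u-1)⁴`. Replacing `u` by `12/t + 1` we get `j = -4t³(t+8)`."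
[cite: DokchitserDokchitserMathZ2012, Lemma (p. 962), proof of (2) ⟹ (3)] -/
theorem exists_j_eq_of_root {q : K} (hq : 64 * q ^ 4 + 32 * W.Δ * q + W.c₄ * W.Δ = 0) :
    ∃ t : K, W.j = -4 * t ^ 3 * (t + 8) := by
  have hΔ : W.Δ ≠ 0 := by rw [← W.coe_Δ']; exact W.Δ'.ne_zero
  have hj := j_mul_Δ W
  by_cases hc : W.c₄ = 0
  · refine ⟨0, ?_⟩
    have : W.j * W.Δ = 0 := by rw [hj, hc]; ring
    rw [(mul_eq_zero.mp this).resolve_right hΔ]; ring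
  · have hq0 : q ≠ 0 := by
      rintro rfl
      apply hc
      have : W.c₄ * W.Δ = 0 := by linear_combination hq
      exact (mul_eq_zero.mp this).resolve_right hΔ
    have h4 : (4 : K) ≠ 0 := by
      rw [show (4 : K) = 2 * 2 by norm_num]; exact mul_ne_zero h2 h2
    have h4q : 4 * q ≠ 0 := mul_ne_zero h4 hq0
    have h4q4 : (4 * q) ^ 4 ≠ 0 := pow_ne_zero 4 h4q
    refine ⟨W.c₄ / (4 * q), ?_⟩
    have ht : -4 * (W.c₄ / (4 * q)) ^ 3 * (W.c₄ / (4 * q) + 8) =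
        -(4 * W.c₄ ^ 3 * (W.c₄ + 32 * q)) / (4 * q) ^ 4 := by
      rw [eq_div_iff h4q4]
      field_simp
      ring
    have hjq : W.j = W.c₄ ^ 3 / W.Δ := by rw [eq_div_iff hΔ, hj]
    rw [ht, hjq, div_eq_div_iff hΔ h4q4]
    linear_combination 4 * W.c₄ ^ 3 * hq

include h2 in
/-- **(3) ⟹ (2) of the Lemma, invariant form:** `j = -4t³(t + 8)` gives the root `q = c₄/(4t)` of
`64X⁴ + 32ΔX + c₄Δ` (`q = 0` if `c₄ = 0`, i.e. `j = 0`, print: "if `a = 0` … `f(0) = 0`").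
[cite: DokchitserDokchitserMathZ2012, Lemma (p. 962), proof ("Reversing the argument gives the other implication")] -/
theorem exists_root_of_j_eq {t : K} (ht : W.j = -4 * t ^ 3 * (t + 8)) :
    ∃ q : K, 64 * q ^ 4 + 32 * W.Δ * q + W.c₄ * W.Δ = 0 := by
  have hΔ : W.Δ ≠ 0 := by rw [← W.coe_Δ']; exact W.Δ'.ne_zero
  have hj := j_mul_Δ W
  by_cases hc : W.c₄ = 0
  · exact ⟨0, by rw [hc]; ring⟩
  · have ht0 : t ≠ 0 := by
      rintro rfl
      apply hc
      have h0 : W.j = 0 := by rw [ht]; ring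
      have : W.c₄ ^ 3 = 0 := by rw [← hj, h0, zero_mul]
      exact pow_eq_zero_iff (by norm_num) |>.mp this
    have h4 : (4 : K) ≠ 0 := by
      rw [show (4 : K) = 2 * 2 by norm_num]; exact mul_ne_zero h2 h2
    have h4t : 4 * t ≠ 0 := mul_ne_zero h4 ht0
    refine ⟨W.c₄ / (4 * t), ?_⟩
    have hcube : W.c₄ ^ 3 + 4 * W.Δ * t ^ 3 * (t + 8) = 0 := by
      linear_combination -hj + W.Δ * ht
    have key : 64 * (W.c₄ / (4 * t)) ^ 4 + 32 * W.Δ * (W.c₄ / (4 * t)) + W.c₄ * W.Δ =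
        W.c₄ * (W.c₄ ^ 3 + 4 * W.Δ * t ^ 3 * (t + 8)) / (4 * t ^ 4) := by
      field_simp
      ring
    rw [key, hcube, mul_zero, zero_div]

/-! ### §3. (1) ⟹ (3): a conjugate of the image inside `ℍ` yields a `K`-rational class -/

namespace LevelFour

/-- An element of `K̄` fixed by `Γ_K` lies in `K` (`K` perfect). [folklore] -/
private theorem exists_eq_algebraMap' [PerfectField K] {x : AlgebraicClosure K}
    (hx : ∀ σ : Field.absoluteGaloisGroup K, σ • x = x) : ∃ q : K, algebraMap K _ q = x := by
  haveI : IsGalois K (AlgebraicClosure K) := {}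
  exact (InfiniteGalois.mem_range_algebraMap_iff_fixed x).mpr fun σ ↦ hx σ

/-- **Dokchitser–Dokchitser's Lemma, (1) ⟹ (3)** (`K` perfect, `char K ∤ 6`, `ρ̄₂` onto): if a
conjugate of `Im ρ̄₄` (in `frame4`) lies in `ℍ`, then `j = -4t³(t + 8)` for some `t ∈ K`. Proof:
the `≡ 1 (mod 2)` part of the image lies in `{±1, ±(1 + 2w₀)}` (conjugates of `ℍ ∩ ker`) and acts
trivially on the four classes, so `σ ↦` (its permutation of the classes) factors through
`GL₂(𝔽₂) ≅ S₃`; the class fixed by a `3`-cycle `σ₃` is unique, hence fixed by every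
`τσ₃τ⁻¹ ∈ {σ₃, σ₃²}·ker` and so by every `τ` ("the stabiliser of `θ_ℍ` is precisely `ℍ` … one of the
`θ_C` is rational"); a rational class is a root of the resolvent (§1), whence `t` (§2).
[cite: DokchitserDokchitserMathZ2012, Lemma (p. 962), (1) ⟹ (2) ⟹ (3)] -/
theorem exists_j_eq_of_conj_subset_HH [PerfectField K] (h3 : (3 : K) ≠ 0)
    (h2s : W.HasSurjectiveModNGaloisRep 2)
    (hk : ∃ k : M4, k.det * k.det = 1 ∧ ∀ σ : Field.absoluteGaloisGroup K,
      tup (k * M W h2 σ * inv' k) ∈ HH) :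
    ∃ t : K, W.j = -4 * t ^ 3 * (t + 8) := by
  obtain ⟨k, hkdet, hkH⟩ := hk
  have hmove : ∀ i : Fin 3, ∃ σ : Field.absoluteGaloisGroup K, σ • T W h2 i ≠ T W h2 i :=
    exists_smul_T_ne W h2 (forall_two_nsmul_of_hasSurjectiveModNGaloisRep_two W h2 h2s)
  have hinj := w_injective W h2 h3 hmove
  -- the permutation of the classes induced by `σ`
  set Ψ : Field.absoluteGaloisGroup K → ZMod 2 × ZMod 2 → ZMod 2 × ZMod 2 :=
    fun σ ↦ actE (pi W h2 σ) (sgnH W h2 σ) with hΨ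
  have hΨw : ∀ σ η, σ • w W h2 η = w W h2 (Ψ σ η) := fun σ η ↦ smul_w W h2 σ η
  have hmul : ∀ σ τ η, Ψ (σ * τ) η = Ψ σ (Ψ τ η) := by
    intro σ τ η
    apply hinj
    rw [← hΨw, ← hΨw, ← hΨw, mul_smul]
  -- the `≡ 1 (mod 2)` elements of the image act trivially
  have hkdet' : Q4.det (tup k) * Q4.det (tup k) = 1 := by rw [← det_eq]; exact hkdet
  have hker : ∀ ν : Field.absoluteGaloisGroup K, pi W h2 ν = 1 → ∀ η, Ψ ν η = η := by
    intro ν hν η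
    have hpar : Q4.par (tup (M W h2 ν)) = (1, 0, 0, 1) := (pi_eq_one_iff W h2 ν).mp hν
    set a := Q4.half (tup (M W h2 ν)) with ha
    have hkl : tup (M W h2 ν) = klift a := eq_klift_half _ hpar
    have hH := hkH ν
    rw [tup_mul, tup_mul, tup_inv', hkl, conj_klift _ hkdet'] at hH
    have haF : a ∈ F4set := mem_F4set_of_conj_mem _
      ((Q4.det_mul_self_iff _).mp hkdet') a (klift_mem_HH_imp _ hH)
    have h4 := klift_F4set_cases a haF
    rw [← hkl] at h4
    exact actE_eq_self_of_tup_mem_four W h2 ν h4 η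
  -- a `3`-cycle and its unique fixed class
  obtain ⟨σ₃, hσ₃⟩ := exists_par_rhoMat_eq_of_two W (frame4 W h2) h2s (0, 1, 1, 1) (by decide)
  have hfree : ∀ i, pi W h2 σ₃ i ≠ i := (pi_ne_forall_iff W h2 σ₃).mpr (Or.inl hσ₃)
  obtain ⟨η₀, hη₀⟩ := actE_existsUnique_fixed (pi W h2 σ₃) hfree (sgnH W h2 σ₃)
  have hfix₀ : Ψ σ₃ η₀ = η₀ := ((hη₀ η₀).1).mpr rfl
  -- every `τ` fixes `η₀`
  have hfix : ∀ τ : Field.absoluteGaloisGroup K, Ψ τ η₀ = η₀ := by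
    intro τ
    have hρ : Ψ (τ * σ₃ * τ⁻¹) (Ψ τ η₀) = Ψ τ η₀ := by
      rw [← hmul, show τ * σ₃ * τ⁻¹ * τ = τ * σ₃ by group, hmul, hfix₀]
    have hpc : pi W h2 (τ * σ₃ * τ⁻¹) = pi W h2 τ * pi W h2 σ₃ * (pi W h2 τ)⁻¹ := by
      rw [pi_mul, pi_mul, pi_inv]
    rcases perm_conj_three_cycle (pi W h2 σ₃) (pi W h2 τ) hfree with hc | hc
    · -- `π(τσ₃τ⁻¹) = π(σ₃)`: `τσ₃τ⁻¹ = σ₃ν` with `π ν = 1`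
      have hν : pi W h2 (σ₃⁻¹ * (τ * σ₃ * τ⁻¹)) = 1 := by
        rw [pi_mul, pi_inv, hpc, hc, inv_mul_cancel]
      have hΨρ : Ψ (τ * σ₃ * τ⁻¹) (Ψ τ η₀) = Ψ σ₃ (Ψ τ η₀) := by
        rw [show τ * σ₃ * τ⁻¹ = σ₃ * (σ₃⁻¹ * (τ * σ₃ * τ⁻¹)) by group, hmul, hker _ hν]
      rw [hΨρ] at hρ
      exact ((hη₀ _).1).mp hρ
    · -- `π(τσ₃τ⁻¹) = π(σ₃)²`: `τσ₃τ⁻¹ = σ₃²ν` with `π ν = 1`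
      have hν : pi W h2 ((σ₃ * σ₃)⁻¹ * (τ * σ₃ * τ⁻¹)) = 1 := by
        rw [pi_mul, pi_inv, pi_mul, hpc, hc, inv_mul_cancel]
      have hΨρ : Ψ (τ * σ₃ * τ⁻¹) (Ψ τ η₀) = Ψ σ₃ (Ψ σ₃ (Ψ τ η₀)) := by
        rw [show τ * σ₃ * τ⁻¹ = σ₃ * σ₃ * ((σ₃ * σ₃)⁻¹ * (τ * σ₃ * τ⁻¹)) by group, hmul, hmul,
          hker _ hν]
      rw [hΨρ] at hρ
      exact ((hη₀ _).2).mp hρ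
  -- so `w_{η₀} ∈ K` is a root of the resolvent
  obtain ⟨q, hq⟩ := exists_eq_algebraMap' (x := w W h2 η₀) fun τ ↦ by rw [hΨw, hfix]
  exact exists_j_eq_of_root W h2 (root_of_w_eq W h2 hq.symm)

/-! ### §4. (3) ⟹ (1): a rational `t` and door B put the image inside a conjugate of `ℍ` -/

/-- **Dokchitser–Dokchitser's Lemma, (3) ⟹ (1)** (`K` perfect, `char K ∤ 6`, `√-1 ∉ K`, `ρ̄₂` onto,
`-Δ ∉ K^{×2}`): if `j = -4t³(t + 8)` for some `t ∈ K`, then a conjugate of `Im ρ̄₄` lies in `ℍ`.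
Proof: `t` gives a `K`-rational root of the resolvent (§2), i.e. a `Γ_K`-fixed class `w_η` (§1);
by door B the alternative is `ρ̄₄` onto, but then some `σ` has `ρ̄₄(σ) = diag(3, 1)`, which moves every
class — contradiction ("the stabilisers of the others are the conjugates of `ℍ`").
[cite: DokchitserDokchitserMathZ2012, Lemma (p. 962), (3) ⟹ (2) ⟹ (1)] -/
theorem conj_subset_HH_of_j_eq [PerfectField K] (h3 : (3 : K) ≠ 0) (hK : ¬ IsSquare (-1 : K))
    (h2s : W.HasSurjectiveModNGaloisRep 2) (hΔ : ¬ IsSquare (-W.Δ)) {t : K}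
    (ht : W.j = -4 * t ^ 3 * (t + 8)) :
    ∃ k : M4, k.det * k.det = 1 ∧ ∀ σ : Field.absoluteGaloisGroup K,
      tup (k * M W h2 σ * inv' k) ∈ HH := by
  rcases hasSurjectiveModNGaloisRep_four_or_conj_subset_HH W h2 h2s hK hΔ with h4 | h
  · exfalso
    have hmove : ∀ i : Fin 3, ∃ σ : Field.absoluteGaloisGroup K, σ • T W h2 i ≠ T W h2 i :=
      exists_smul_T_ne W h2 (forall_two_nsmul_of_hasSurjectiveModNGaloisRep_two W h2 h2s)
    obtain ⟨q, hq⟩ := exists_root_of_j_eq W h2 ht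
    obtain ⟨η₀, hη₀⟩ := exists_w_eq_of_root W h2 hq
    obtain ⟨σ, hσ⟩ := (hasSurjectiveModNGaloisRep_iff_matrix W (frame4 W h2)).mp h4
      (!![3, 0; 0, 1] : M4) ⟨3, by decide⟩
    have htup : tup (M W h2 σ) = (3, 0, 0, 1) := by
      rw [show M W h2 σ = !![3, 0; 0, 1] from hσ]; rfl
    refine actE_diag_ne_self W h2 σ htup η₀ (w_injective W h2 h3 hmove ?_)
    rw [← smul_w, hη₀]
    exact (show AlgebraicClosure K ≃ₐ[K] AlgebraicClosure K from σ).commutes q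
  · exact h

/-- **Dokchitser–Dokchitser's Lemma (1) ⟺ (3) over a perfect field** with `char K ∤ 6`,
`√-1 ∉ K`, under `ρ̄₂` onto and `-Δ ∉ K^{×2}` (the hypotheses of the Theorem's clause (2)):
a conjugate of `Im ρ̄₄` (in `frame4`) lies in `ℍ` iff `j = -4t³(t + 8)` for some `t ∈ K`.
[cite: DokchitserDokchitserMathZ2012, Lemma (p. 962), (1) ⟺ (3)] -/
theorem conj_subset_HH_iff_exists_j_eq [PerfectField K] (h3 : (3 : K) ≠ 0)
    (hK : ¬ IsSquare (-1 : K)) (h2s : W.HasSurjectiveModNGaloisRep 2) (hΔ : ¬ IsSquare (-W.Δ)) :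
    (∃ k : M4, k.det * k.det = 1 ∧ ∀ σ : Field.absoluteGaloisGroup K,
        tup (k * M W h2 σ * inv' k) ∈ HH) ↔ ∃ t : K, W.j = -4 * t ^ 3 * (t + 8) :=
  ⟨exists_j_eq_of_conj_subset_HH W h2 h3 h2s, fun ⟨_, ht⟩ ↦ conj_subset_HH_of_j_eq W h2 h3 hK h2s hΔ ht⟩

end LevelFour

/-! ### §5. Over `ℚ`: the Lemma, clause (2), and the Theorem -/

/-- `-1` is not a square in `ℚ`. [folklore] -/
private theorem not_isSquare_neg_one_rat'' : ¬ IsSquare (-1 : ℚ) := by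
  rintro ⟨r, hr⟩
  have := mul_self_nonneg r
  linarith

/-- **Dokchitser–Dokchitser's Lemma over `ℚ`, (1) ⟺ (3)**, in the hypothesis spelling of
`hasSurjectiveModNGaloisRep_four_iff_of_lemma` / `…_of_lemma` (frame `LevelFour.frame4`;
under `ρ̄₂` onto, `-Δ ∉ ℚ^{×2}`; the binder `c₆ ≠ 0` = print's `b ≠ 0` is implied by `ρ̄₂` onto and
unused): `Gal(ℚ(E[4])/ℚ)` is conjugate to a subgroup of `ℍ` iff `j(E) = -4t³(t + 8)` for some
`t ∈ ℚ`. [cite: DokchitserDokchitserMathZ2012, Lemma (p. 962), (1) ⟺ (3)] -/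
theorem conj_subset_HH_iff_exists_j_eq (W : WeierstrassCurve ℚ) [W.IsElliptic] :
    W.HasSurjectiveModNGaloisRep 2 → ¬ IsSquare (-W.Δ) → W.c₆ ≠ 0 →
      ((∃ k : M4, k.det * k.det = 1 ∧ ∀ σ : Field.absoluteGaloisGroup ℚ,
          tup (k * LevelFour.M W two_ne_zero σ * inv' k) ∈ HH) ↔
        ∃ t : ℚ, W.j = -4 * t ^ 3 * (t + 8)) := fun h2s hΔ _ ↦ by
  haveI : PerfectField ℚ := PerfectField.ofCharZero
  exact LevelFour.conj_subset_HH_iff_exists_j_eq W two_ne_zero (by norm_num)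
    not_isSquare_neg_one_rat'' h2s hΔ

/-- **Dokchitser–Dokchitser 2012, Theorem (2) — PROVED.** For an elliptic curve `E/ℚ` (any model
`W`): `ρ̄_{E,4}` is onto iff `ρ̄_{E,2}` is onto, `Δ ∉ -1·ℚ^{×2}` and `j(E) ≠ -4t³(t + 8)` for all
`t ∈ ℚ`. [cite: DokchitserDokchitserMathZ2012, Theorem (2)] -/
theorem hasSurjectiveModNGaloisRep_four_iff (W : WeierstrassCurve ℚ) [W.IsElliptic] :
    W.HasSurjectiveModNGaloisRep 4 ↔
      W.HasSurjectiveModNGaloisRep 2 ∧ ¬ IsSquare (-W.Δ) ∧ ∀ t : ℚ, W.j ≠ -4 * t ^ 3 * (t + 8) :=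
  hasSurjectiveModNGaloisRep_four_iff_of_lemma W (conj_subset_HH_iff_exists_j_eq W)

end Literature.NumberTheory.EllipticCurves.DokchitserDokchitser2012

namespace Literature.NumberTheory.EllipticCurves

/-- **DISCHARGE of the named fact `DokchitserDokchitser2012_surjective_mod_two_four_eight`**
(T. Dokchitser, V. Dokchitser, Math. Z. 272 (2012), Theorem (1)–(3)): clause (1) is
`hasSurjectiveModNGaloisRep_two_iff`, clause (3) is `hasSurjectiveModNGaloisRep_eight_iff`, and
clause (2) follows from their Lemma, proved above (`conj_subset_HH_iff_exists_j_eq`), through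
`DokchitserDokchitser2012_surjective_mod_two_four_eight_of_lemma`. No hypothesis, no new fact.
[cite: DokchitserDokchitserMathZ2012, Theorem (1)–(3) and Lemma] -/
theorem DokchitserDokchitser2012_surjective_mod_two_four_eight_holds :
    DokchitserDokchitser2012_surjective_mod_two_four_eight :=
  DokchitserDokchitser2012_surjective_mod_two_four_eight_of_lemma fun W _ ↦
    DokchitserDokchitser2012.conj_subset_HH_iff_exists_j_eq W

/-- **Per-curve criterion for a surjective `2`-adic image — UNCONDITIONAL.** For an elliptic curve
`E/ℚ` (any model `W`): if `E(ℚ)` has no point of order `2`, none of `Δ, -Δ, 2Δ, -2Δ` is a rational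
square and `j(E) ≠ -4t³(t + 8)` for all `t ∈ ℚ`, then `ρ̄_{E,2ⁿ}` is onto for every `n` (the habitat
binder `TwoAdicSurjective W` of the X5 routes, per curve). This is
`hasSurjectiveModNGaloisRep_two_pow_of_criteria` fed with the two discharges
`DokchitserDokchitser2012_surjective_mod_two_four_eight_holds` (Dokchitser–Dokchitser's Theorem) and
`hasSurjectiveModNGaloisRep_two_pow_of_eight_holds` (the mod-`8` ⟹ `2`-adic lift).
[cite: DokchitserDokchitserMathZ2012, Theorem (p. 961)] [cite: RouseZureickbrown2015, §3 Lemma and §1] -/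
theorem twoAdicImage_surjective_of_criteria (W : WeierstrassCurve ℚ) [W.IsElliptic]
    (h2 : ∀ P : W.toAffine.Point, 2 • P = 0 → P = 0) (hΔ : ¬ IsSquare W.Δ)
    (hΔ₁ : ¬ IsSquare (-W.Δ)) (hΔ₂ : ¬ IsSquare (2 * W.Δ)) (hΔ₃ : ¬ IsSquare (-2 * W.Δ))
    (hj : ∀ t : ℚ, W.j ≠ -4 * t ^ 3 * (t + 8)) (n : ℕ) :
    W.HasSurjectiveModNGaloisRep ((2 : ℤ) ^ n) :=
  hasSurjectiveModNGaloisRep_two_pow_of_criteria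
    DokchitserDokchitser2012_surjective_mod_two_four_eight_holds
    hasSurjectiveModNGaloisRep_two_pow_of_eight_holds W h2 hΔ hΔ₁ hΔ₂ hΔ₃ hj n

end Literature.NumberTheory.EllipticCurves

end
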